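/-
Copyright: cell `pub-ymgap` (HUMAN RULING D-0062), Track A of `YM-PLAN.md`, DAG node N20 (= NE7b); R134 acceleration seat
`pub-ymgap-dag-n20-c` (strategy s1, generation 10), module 54.  Released under the licence of the surrounding project.
-/
import Summits.QuantumFields.YangMills.Theorems.BalabanUVNodesN20LCSSmallCouplingInstance
import HarnessLib

/-!
# YM-DAG node N20 (= NE7b), row s1, module 54: THE ROW's TWO NAMED PROPS `PointwiseExtraction ∧ LocCondStability` FOR ARBITRARY PINNED FAMILIES
# BELOW `g⋆` — inhabited on a 39^d-dense skeleton of the pins with stability exponents `≤ −δ·C·A·M_h²·#D′_j`, MODULO (W♮) + (T♮)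

Track A of `YM-PLAN.md` (cell `pub-ymgap`, HUMAN RULING D-0062), node **N20** = spine estimate NE7b (`T4WeightBudget.RelWeightBound`, NOT
PRINTED, NOT PROVED).  Seat `pub-ymgap-dag-n20-c` (R134, s1), generation 10, module 54 (imports module 53 `…N20LCSSmallCouplingInstance`).  One kernel theorem
+ an A2 certificate: 0 `def`, 0 `sorry`, standard axioms; COUNT-NEUTRAL.  Composition of module 48 §5 (the named Props on DISJOINT regularity regions) with module 51's
skeleton ∕ size theorems and module 52's per-level regime; it asserts nothing of Bałaban's.

WHY.  The row reads «INSTANCE `Spine/NE7b/LocalConditionalStability.LocCondStability` (+ `PointwiseExtraction`, window ledger) for Bałaban's tower at a pinned 𝐑𝐓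
step».  Module 48 §5 inhabits both named Props on Bałaban's label tower at the residual of record MODULO (W) + (T) — for pinned families with PAIRWISE DISJOINT
regularity regions of bounded size and with the regime's bookkeeping numbers (`m`, rates) supplied by the consumer.  Modules 51–53 removed every such input from the
class-weight face.  THIS FILE does the same for the NAMED-PROPS face:
* ★★★ **`halves_of_le_gstar_of_any`** — for ARBITRARY pinned families `D_j` (pinned levels `j ∈ J`, `j < K`) whose couplings satisfy `0 < g_{j+1} ≤ g⋆` (module 52
  §2's explicit `g⋆`), THERE IS a skeleton `D′_j ⊆ D_j` (`#D_j ≤ 39^d·#D′_j`, pairwise disjoint canonical regions — module 51 §1) such that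
  `PointwiseExtraction` (extracted exponents `0`) AND `LocCondStability` HOLD on Bałaban's label tower at the residual of record along the label pattern of `E`,
  with the WINDOWED indicator carriers of module 41 over `D′` and the canonical regions `R♮_j(c)` at threshold `ε(g_{j+1})∕B`, and with stability exponents
  `log (rate j) ≤ −δ·C·A·M_h²·#D′_j ≤ −(δ·C·A·M_h²∕39^d)·#D_j` at the pinned levels (`0` elsewhere) — MODULO (W♮) «LCS-j on the hull of the (3.2) window's
  canonical regions» (level-uniform `C`) + (T♮) (the LOCAL [Balaban1985Variational] Thm 1 (9) shape at every cube) + the side conditions among the free constants.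
  The skeleton is existential (the greedy choice of module 26 is not canonical); the class-weight bound for ALL of `D` is module 53.
* `sideConditions_inhabited` — the A2 certificate of 52–54: for EVERY `a₀ > 0` (the exponent range is (W♮)'s) there are `α, δ` meeting the guard and
  `δ·A·M_h ≤ a₀` (`δ` is chosen AFTER `a₀`; module 49 §5's witnesses, re-run).

HONEST FRAMING.  Composition only; no estimate of Bałaban's.  (W♮) ((A1c), THE wall, NOT PRINTED as a statement) and (T♮) (K0's pen; see HOME
`N20-S1-RESIDUAL.md` for a CAUTION on its premise) stay DISPLAYED; `M ≫ M₂` (module 43) stays a displayed numerics side condition of the lineage; `g⋆` is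
crude.  The carriers are the (α)-road's windowed indicators (reading NC-NE7b-α UNRULED).  NE7b NOT PRINTED ∕ NOT PROVED; (α)-instance 0∕1 — this is the
instance MODULO TWO STATEMENTS OF PRINT's KIND, not the instance; N20 NOT discharged; typed 28∕28, count untouched; one finite four-torus at fixed `ε` —
NOT ℝ⁴, NOT infinite volume, NOT OS, NOT a mass gap, NOT Clay.

References (LOCATORS): T. Bałaban, CMP 122 (1989) 175–202 [Balaban1989LargeFieldI] ((0.3)–(0.5) pp.176–177: the KIND of «LCS-j»); CMP 122 (1989) 355–392
[Balaban1989LargeFieldII] ((1.79)–(1.80) pp.383–384, p.383 l.21–28); CMP 119 (1988) 243–285 [Balaban1988Convergent] ((2.4)–(2.5) p.255, (2.16)–(2.17) p.257,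
(3.2) p.265); CMP 102 (1985) 277–309 [Balaban1985Variational] (Thm 1 (9) p.279).
-/

set_option autoImplicit false

noncomputable section

open scoped BigOperators ENNReal

namespace Summit.QuantumFields.YangMills.BalabanUVNodes.N20LCSNamedPropsOfAny

open MeasureTheory
open Literature.MathematicalPhysics.QuantumFieldTheory.Balaban1983to89
open Literature.MathematicalPhysics.QuantumFieldTheory.Balaban1983to89.T4Continuum
open Literature.MathematicalPhysics.QuantumFieldTheory.Balaban1983to89.B14.Eq218Concrete
open Literature.MathematicalPhysics.QuantumFieldTheory.Balaban1983to89.Node00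
open B15DeterminingSets B14.Eq213DetSet B14.Eq216Concrete B14.Eq213MaximalDomains B15Eq112TorusCover B14DomainGeom
open Literature.MathematicalPhysics.QuantumFieldTheory.BalabanImbrieJaffe1984to88.BIJ85Eq453GaugeField (qsstarGIter0)
open ExpMeanLog (deltaSU)
open Summit.QuantumFields.BalabanUV.T4Continuum.B16HistoryIndexedRepr (GoodClass)
open Summit.QuantumFields.BalabanUV.T4Continuum.B16HistoryReprChain
open Summit.QuantumFields.BalabanUV.T4Continuum.NE7b.PrefixExtraction (admS)
open Summit.QuantumFields.BalabanUV.T4Continuum.NE7b.LocalConditionalStability (LocCondStability PointwiseExtraction)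
open Summit.QuantumFields.YangMills.BalabanUVNodes.N20LCSLabelTower
open Summit.QuantumFields.YangMills.BalabanUVNodes.N20LCSAvgDominationRegion (boxRegion)
open Summit.QuantumFields.YangMills.BalabanUVNodes.N20LCSPeierlsRegime (pow_mul_exp_le_exp_neg_mul inv_sq_mul_div_sq)
open Summit.QuantumFields.YangMills.BalabanUVNodes.N20LCSInstanceModuloTwo (halves_rec_pinnedLevels_hullWindow_of_regularity)
open Summit.QuantumFields.YangMills.BalabanUVNodes.N20LCSCanonicalRegion (mem_canon_iff)
open Summit.QuantumFields.YangMills.BalabanUVNodes.N20LCSCanonicalSkeleton (exists_canon_skeleton card_canon_le hLSw_of_window)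
open Summit.QuantumFields.YangMills.BalabanUVNodes.N20LCSSmallCouplingRegime (one_le_regionSize threshold_le_p0Profile_sq_of_le_gstar)
open Summit.QuantumFields.YangMills.BalabanUVNodes.N20LCSSmallCouplingInstance (epsOfRecord_mul_eta_sq_pos)

variable (F : T4Family) (N : ℕ) [NeZero N] (ν : Stage7Numerics) (M : ℕ) (p : B12.RunParams) (g : ℕ → ℝ) (A₁ : ℝ)

/-- **THE SIDE CONDITIONS AMONG THE FREE CONSTANTS ARE INHABITED FOR EVERY `a₀ > 0`** (A2 certificate for modules 52–54: the exponent range `a₀` is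
(W♮)'s to give, and `δ` is then CHOSEN — `δ = a₀∕(A·M_h + 1)`; `α = δ_SU²∕(8N(c+1)²)`, `c = ((d+2)L)²∕4`, meets the averaging guard as in module 49 §5). [folklore] -/
theorem sideConditions_inhabited (a₀ : ℝ) (ha₀ : 0 < a₀) :
    ∃ α δ : ℝ, 0 < α ∧
      (((((F.P p.K).d + 2) * (F.P p.K).L : ℕ) : ℝ) ^ 2 / 4) * Real.sqrt (2 * (Fintype.card (Fin N) : ℝ) * α) < deltaSU (Fin N) ∧
      0 < δ ∧
      δ * ((2 * (Fintype.card (Fin N) : ℝ) * (((F.P p.K).L : ℝ) ^ 2 + 6 * ((((F.P p.K).d + 2) * (F.P p.K).L : ℕ) : ℝ) ^ 2) ^ 2 +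
        2 / α) * (((2 * (((F.P p.K).d + 3) * (F.P p.K).L + 2) + 1) ^ (F.P p.K).d * (F.P p.K).d ^ 2 : ℕ) : ℝ)) ≤ a₀ := by
  haveI : Nonempty (Fin N) := ⟨⟨0, Nat.pos_of_ne_zero (NeZero.ne N)⟩⟩
  set N' : ℝ := (Fintype.card (Fin N) : ℝ) with hN'
  have hNpos : 0 < N' := by rw [hN', Fintype.card_fin]; exact_mod_cast Nat.pos_of_ne_zero (NeZero.ne N)
  set c : ℝ := ((((F.P p.K).d + 2) * (F.P p.K).L : ℕ) : ℝ) ^ 2 / 4 with hc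
  have hc0 : 0 ≤ c := by positivity
  have hδSU : 0 < deltaSU (Fin N) := ExpMeanLog.deltaSU_pos
  set α : ℝ := deltaSU (Fin N) ^ 2 / (8 * N' * (c + 1) ^ 2) with hα
  have hαpos : 0 < α := by positivity
  set Ad : ℝ := 2 * N' * (((F.P p.K).L : ℝ) ^ 2 + 6 * ((((F.P p.K).d + 2) * (F.P p.K).L : ℕ) : ℝ) ^ 2) ^ 2 + 2 / α with hAd
  set Mh : ℝ := (((2 * (((F.P p.K).d + 3) * (F.P p.K).L + 2) + 1) ^ (F.P p.K).d * (F.P p.K).d ^ 2 : ℕ) : ℝ) with hMh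
  have hAM : 0 ≤ Ad * Mh := by positivity
  refine ⟨α, a₀ / (Ad * Mh + 1), hαpos, ?_, by positivity, ?_⟩
  · -- the guard: `c·√(2N′α) = c·δ_SU∕(2(c+1)) < δ_SU` (module 49 §5)
    have h2 : 2 * N' * α = (deltaSU (Fin N) / (2 * (c + 1))) ^ 2 := by
      rw [hα]; field_simp; ring
    rw [h2, Real.sqrt_sq (by positivity)]
    have h3 : c * (deltaSU (Fin N) / (2 * (c + 1))) = deltaSU (Fin N) * (c / (2 * (c + 1))) := by ring
    rw [h3]
    have h4 : c / (2 * (c + 1)) < 1 := by rw [div_lt_one (by positivity)]; linarith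
    calc deltaSU (Fin N) * (c / (2 * (c + 1))) < deltaSU (Fin N) * 1 := mul_lt_mul_of_pos_left h4 hδSU
      _ = deltaSU (Fin N) := mul_one _
  · -- `δ·(A·M_h) = a₀·(A·M_h)∕(A·M_h + 1) ≤ a₀`
    rw [div_mul_eq_mul_div, div_le_iff₀ (by positivity)]
    nlinarith

open Classical in
/-- ★★★ **`PointwiseExtraction ∧ LocCondStability` FOR ARBITRARY PINNED FAMILIES BELOW `g⋆`, MODULO (W♮) + (T♮)** — on a 39^d-dense skeleton `D′ ⊆ D` with
pairwise disjoint canonical regions (module 51 §1), with module 41's windowed indicator carriers at threshold `ε(g_{j+1})∕B` and stability exponents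
`log (rate j) ≤ −δ·C·A·M_h²·#D′_j` at the pinned levels (module 48 §5 on the skeleton; module 52 §2 supplies the per-level threshold from `g_{j+1} ≤ g⋆`,
module 53 the positivity letter). [cite: Balaban1989LargeFieldI, (0.3)–(0.5) pp.176–177; Balaban1989LargeFieldII, (1.79)–(1.80) pp.383–384; Balaban1985Variational, Thm 1 (9) p.279] -/
theorem halves_of_le_gstar_of_any {ρ₀ : cfgOfRecord F N p.K 0 → ℝ}
    (hρ : (bddMeas (cfgOfRecord F N p.K 0)).Gd ρ₀) (h0 : ∀ U, 0 ≤ ρ₀ U) (hM₂ : 0 < ν.M₂)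
    (J : Finset ℕ) (hJ : ∀ j ∈ J, j < p.K)
    (D : (j : ℕ) → Finset (Iχ F ν p g j)) {B : ℝ} (hB : 0 < B)
    (hA0 : 0 < ν.A₀) (hp0 : 1 ≤ ν.p₀)
    (hThm1 : ∀ j ∈ J, ∀ (c : Iχ F ν p g j) (V' : GaugeField (F.P p.K) (j + 1) (SU N)) (U₀ : GaugeField (F.P p.K) 0 (SU N)),
      IsMinimizer (avOfRecord F N p.K) {U | PlaqSmall (ν.εreg * (F.P p.K).eta (j + 1) ^ 2) U}
          (Bj ν.M₁ (cubeEnl (F.P p.K) (sideχ F ν p g j) c 4) (j + 1)) (avgFamily (avOfRecord F N p.K) (qsstarGIter0 (j + 1) V')) U₀ →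
      (∀ p' : Plaq (F.P p.K) (j + 1), embIter (j + 1) p'.src ∈ cubeEnl (F.P p.K) (sideχ F ν p g j) c 4 →
        dist1 (GaugeField.plaqHol V' p') < epsOfRecord ν g (j + 1) / B) →
      PlaqSmallOn (plaqInside (cubeEnl (F.P p.K) (sideχ F ν p g j) c 1)) (epsOfRecord ν g (j + 1) * (F.P p.K).eta (j + 1) ^ 2) U₀)
    {α C a₀ δ : ℝ} (hα : 0 < α)
    (hguard : (((((F.P p.K).d + 2) * (F.P p.K).L : ℕ) : ℝ) ^ 2 / 4) * Real.sqrt (2 * (Fintype.card (Fin N) : ℝ) * α) < deltaSU (Fin N))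
    (hC : 0 ≤ C) (hδ : 0 < δ)
    (hδa : δ * ((2 * (Fintype.card (Fin N) : ℝ) * (((F.P p.K).L : ℝ) ^ 2 + 6 * ((((F.P p.K).d + 2) * (F.P p.K).L : ℕ) : ℝ) ^ 2) ^ 2 +
        2 / α) * (((2 * (((F.P p.K).d + 3) * (F.P p.K).L + 2) + 1) ^ (F.P p.K).d * (F.P p.K).d ^ 2 : ℕ) : ℝ)) ≤ a₀)
    (hgstar : ∀ j ∈ J, 0 < g (j + 1) ∧ g (j + 1) ≤ Real.exp (-(max 1
      ((4 * (Fintype.card (Fin N) : ℝ) * B ^ 2 *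
          (C * ((2 * (Fintype.card (Fin N) : ℝ) * (((F.P p.K).L : ℝ) ^ 2 + 6 * ((((F.P p.K).d + 2) * (F.P p.K).L : ℕ) : ℝ) ^ 2) ^ 2 + 2 / α) *
              (((2 * (((F.P p.K).d + 3) * (F.P p.K).L + 2) + 1) ^ (F.P p.K).d * (F.P p.K).d ^ 2 : ℕ) : ℝ)) *
              (((2 * (((F.P p.K).d + 3) * (F.P p.K).L + 2) + 1) ^ (F.P p.K).d * (F.P p.K).d ^ 2 : ℕ) : ℝ) +
            Real.log (((F.P p.K).d ^ 2 * (9 * (F.P p.K).L * (F.P p.K).L * ν.M₂) ^ (F.P p.K).d : ℕ) : ℝ) / δ) +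
        4 * (Fintype.card (Fin N) : ℝ) * B ^ 2 * ((ν.r * (F.P p.K).d : ℕ) : ℝ) / δ) / ν.A₀ ^ 2)) / 2))
    (K' : ℕ) (E : (j : ℕ) → (Fin j → LabelPat F ν p g) → Finset (LbOfRecord F ν p g j)) (hE : ∀ j ∈ J, ∀ h t, t ∈ E j h → D j ⊆ t.1)
    (hW : ∀ j ∈ J, j < K' → ∀ h : Fin j → LabelPat F ν p g,
      h ∈ admS (labelTowerOfRecord F N ν M p g A₁ (zeta316OfRecord F N ν M A₁)) (labelPattern F ν p g E) j →
      ∀ a : ℝ, 0 ≤ a → a ≤ a₀ → ∀ X : Finset (Plaq (F.P p.K) j),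
        (∀ q ∈ X, ∃ c ∈ cubes32 F ν M p g j (seqOfHist F ν M p g j h),
          ∃ p' ∈ (Finset.univ.filter fun q : Plaq (F.P p.K) (j + 1) => embIter (j + 1) q.src ∈ cubeEnl (F.P p.K) (sideχ F ν p g j) c 4),
            q ∈ boxRegion (emb p'.src) (((F.P p.K).d + 3) * (F.P p.K).L + 2)) →
        ∫ U, Real.exp (a * ((g (j + 1)) ^ 2)⁻¹ * ∑ q ∈ X, (1 - reTr (GaugeField.plaqHol U q))) *
            (labelTowerOfRecord F N ν M p g A₁ (zeta316OfRecord F N ν M A₁)).eterm ρ₀ j h U ∂(lawOfRecord F N p.K j) ≤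
          Real.exp (C * a * X.card) * ∫ U, (labelTowerOfRecord F N ν M p g A₁ (zeta316OfRecord F N ν M A₁)).eterm ρ₀ j h U ∂(lawOfRecord F N p.K j)) :
    ∃ D' : (j : ℕ) → Finset (Iχ F ν p g j), (∀ j, D' j ⊆ D j) ∧ (∀ j, (D j).card ≤ 39 ^ (F.P p.K).d * (D' j).card) ∧
      (∀ j, ∀ c₁ ∈ D' j, ∀ c₂ ∈ D' j, c₁ ≠ c₂ → Disjoint
        (Finset.univ.filter fun q : Plaq (F.P p.K) (j + 1) => embIter (j + 1) q.src ∈ cubeEnl (F.P p.K) (sideχ F ν p g j) c₁ 4)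
        (Finset.univ.filter fun q : Plaq (F.P p.K) (j + 1) => embIter (j + 1) q.src ∈ cubeEnl (F.P p.K) (sideχ F ν p g j) c₂ 4)) ∧
      PointwiseExtraction (labelTowerOfRecord F N ν M p g A₁ (zeta316OfRecord F N ν M A₁)) (labelPattern F ν p g E) K'
          (labelChi F N ν M p g A₁ (zeta316OfRecord F N ν M A₁))
          (fun j h U => if j ∈ J then (if D' j ⊆ cubes32 F ν M p g j (seqOfHist F ν M p g j h) then
            Set.indicator {U : cfgOfRecord F N p.K j | ∀ c ∈ D' j, ∃ p' ∈ (Finset.univ.filter fun q : Plaq (F.P p.K) (j + 1) => embIter (j + 1) q.src ∈ cubeEnl (F.P p.K) (sideχ F ν p g j) c 4),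
              epsOfRecord ν g (j + 1) / B ≤ dist1 (GaugeField.plaqHol ((avOfRecord F N p.K j).avg U) p')} (fun _ => (1 : ℝ)) U else 0) else 1)
          (fun _ _ => 0) ∧
      LocCondStability (labelTowerOfRecord F N ν M p g A₁ (zeta316OfRecord F N ν M A₁)) (labelPattern F ν p g E) K' (lawOfRecord F N p.K) ρ₀
          (fun j h U => if j ∈ J then (if D' j ⊆ cubes32 F ν M p g j (seqOfHist F ν M p g j h) then
            Set.indicator {U : cfgOfRecord F N p.K j | ∀ c ∈ D' j, ∃ p' ∈ (Finset.univ.filter fun q : Plaq (F.P p.K) (j + 1) => embIter (j + 1) q.src ∈ cubeEnl (F.P p.K) (sideχ F ν p g j) c 4),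
              epsOfRecord ν g (j + 1) / B ≤ dist1 (GaugeField.plaqHol ((avOfRecord F N p.K j).avg U) p')} (fun _ => (1 : ℝ)) U else 0) else 1)
          (fun j _ => if j ∈ J then Real.log (((((F.P p.K).d ^ 2 * (9 * ((F.P p.K).L * ν.M₂ * RkOfRecord (F.P p.K).L ν.r (g (j + 1)))) ^ (F.P p.K).d : ℕ) : ℝ) * Real.exp (C * ((2 * (Fintype.card (Fin N) : ℝ) * (((F.P p.K).L : ℝ) ^ 2 + 6 * ((((F.P p.K).d + 2) * (F.P p.K).L : ℕ) : ℝ) ^ 2) ^ 2 + 2 / α) * (((2 * (((F.P p.K).d + 3) * (F.P p.K).L + 2) + 1) ^ (F.P p.K).d * (F.P p.K).d ^ 2 : ℕ) : ℝ)) * (((2 * (((F.P p.K).d + 3) * (F.P p.K).L + 2) + 1) ^ (F.P p.K).d * (F.P p.K).d ^ 2 : ℕ) : ℝ) * δ - δ * ((g (j + 1)) ^ 2)⁻¹ * ((epsOfRecord ν g (j + 1) / B) ^ 2 / (2 * (Fintype.card (Fin N) : ℝ))))) ^ (D' j).card) else 0) ∧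
      (∀ j ∈ J, Real.log (((((F.P p.K).d ^ 2 * (9 * ((F.P p.K).L * ν.M₂ * RkOfRecord (F.P p.K).L ν.r (g (j + 1)))) ^ (F.P p.K).d : ℕ) : ℝ) * Real.exp (C * ((2 * (Fintype.card (Fin N) : ℝ) * (((F.P p.K).L : ℝ) ^ 2 + 6 * ((((F.P p.K).d + 2) * (F.P p.K).L : ℕ) : ℝ) ^ 2) ^ 2 + 2 / α) * (((2 * (((F.P p.K).d + 3) * (F.P p.K).L + 2) + 1) ^ (F.P p.K).d * (F.P p.K).d ^ 2 : ℕ) : ℝ)) * (((2 * (((F.P p.K).d + 3) * (F.P p.K).L + 2) + 1) ^ (F.P p.K).d * (F.P p.K).d ^ 2 : ℕ) : ℝ) * δ - δ * ((g (j + 1)) ^ 2)⁻¹ * ((epsOfRecord ν g (j + 1) / B) ^ 2 / (2 * (Fintype.card (Fin N) : ℝ))))) ^ (D' j).card) ≤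
        -(δ * (C * ((2 * (Fintype.card (Fin N) : ℝ) * (((F.P p.K).L : ℝ) ^ 2 + 6 * ((((F.P p.K).d + 2) * (F.P p.K).L : ℕ) : ℝ) ^ 2) ^ 2 + 2 / α) * (((2 * (((F.P p.K).d + 3) * (F.P p.K).L + 2) + 1) ^ (F.P p.K).d * (F.P p.K).d ^ 2 : ℕ) : ℝ)) * (((2 * (((F.P p.K).d + 3) * (F.P p.K).L + 2) + 1) ^ (F.P p.K).d * (F.P p.K).d ^ 2 : ℕ) : ℝ))) * (D' j).card) := by
  -- constants, left-nested as in module 40 ∕ 48 ∕ 52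
  set N' : ℝ := (Fintype.card (Fin N) : ℝ) with hN'
  set Ad : ℝ := 2 * N' * (((F.P p.K).L : ℝ) ^ 2 + 6 * ((((F.P p.K).d + 2) * (F.P p.K).L : ℕ) : ℝ) ^ 2) ^ 2 + 2 / α with hAd
  set Mh : ℝ := (((2 * (((F.P p.K).d + 3) * (F.P p.K).L + 2) + 1) ^ (F.P p.K).d * (F.P p.K).d ^ 2 : ℕ) : ℝ) with hMh
  set Λ : ℝ := C * (Ad * Mh) * Mh with hΛ
  have hNpos : 0 < N' := by rw [hN', Fintype.card_fin]; exact_mod_cast Nat.pos_of_ne_zero (NeZero.ne N)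
  have hΛ0 : 0 ≤ Λ := by positivity
  have hL2 : 2 ≤ (F.P p.K).L := by rw [T4Family.P_L]; have := F.hL.2; omega
  -- the regime: `0 < g_{j+1} < 1`, the positivity letter, the per-level threshold (modules 52 §2, 53)
  have hg0 : ∀ j ∈ J, 0 < g (j + 1) := fun j hj => (hgstar j hj).1
  have hg1 : ∀ j ∈ J, g (j + 1) < 1 := fun j hj =>
    lt_of_le_of_lt (hgstar j hj).2 (by
      rw [Real.exp_lt_one_iff, neg_div, neg_lt_zero]; exact div_pos (lt_max_iff.2 (Or.inl one_pos)) two_pos)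
  have hεη : ∀ j ∈ J, 0 < epsOfRecord ν g (j + 1) * (F.P p.K).eta (j + 1) ^ 2 := fun j hj =>
    epsOfRecord_mul_eta_sq_pos F ν p g hA0 (hg0 j hj) (hg1 j hj)
  have hsmall : ∀ j ∈ J, 4 * N' * B ^ 2 * (Λ +
      Real.log (((F.P p.K).d ^ 2 * (9 * ((F.P p.K).L * ν.M₂ * RkOfRecord (F.P p.K).L ν.r (g (j + 1)))) ^ (F.P p.K).d : ℕ) : ℝ) / δ) ≤
      p0Profile ν.A₀ ν.p₀ (g (j + 1)) ^ 2 := fun j hj =>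
    threshold_le_p0Profile_sq_of_le_gstar ν.r hNpos hB hΛ0 hδ hA0 hp0 (F.P p.K).hd hL2 hM₂ (hg0 j hj) (hgstar j hj).2
  -- the skeleton (module 51 §1) and the explicit sizes (module 51 §2)
  choose D' hsub hdisj hK using fun j => exists_canon_skeleton F ν p g j hM₂ (D j)
  set mχ : ℕ → ℕ := fun j => (F.P p.K).d ^ 2 * (9 * ((F.P p.K).L * ν.M₂ * RkOfRecord (F.P p.K).L ν.r (g (j + 1)))) ^ (F.P p.K).d with hmχ
  have hm : ∀ j ∈ J, ∀ c ∈ D' j,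
      (Finset.univ.filter fun q : Plaq (F.P p.K) (j + 1) =>
        embIter (j + 1) q.src ∈ cubeEnl (F.P p.K) (sideχ F ν p g j) c 4).card ≤ mχ j := by
    intro j hj c _
    have hjK : j + 1 ≤ (F.P p.K).m + (F.P p.K).K := by
      have := hJ j hj; rw [T4Family.P_K]; omega
    exact card_canon_le F ν p g j hjK c
  have hm1 : ∀ j, (1 : ℝ) ≤ (mχ j : ℝ) := fun j => one_le_regionSize F ν p g hM₂ j
  have hε0 : ∀ j ∈ J, 0 ≤ epsOfRecord ν g (j + 1) / B := fun j hj =>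
    div_nonneg (pos_of_mul_pos_left (hεη j hj) (sq_nonneg _)).le hB.le
  set rate : ℕ → ℝ := fun j =>
    ((mχ j : ℝ) * Real.exp (Λ * δ - δ * ((g (j + 1)) ^ 2)⁻¹ * ((epsOfRecord ν g (j + 1) / B) ^ 2 / (2 * N')))) ^ (D' j).card
    with hrate_def
  have hrate0 : ∀ j ∈ J, 0 < rate j := fun j _ =>
    pow_pos (mul_pos (lt_of_lt_of_le one_pos (hm1 j)) (Real.exp_pos _)) _
  -- level by level: `rate j ≤ exp(−δΛ·#D′_j)` (module 47 §1 at the exact gain `p₀(g)²∕B²`)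
  have hlevel : ∀ j ∈ J, rate j ≤ Real.exp (-(δ * Λ) * (D' j).card) := by
    intro j hj
    have hPj := hsmall j hj
    have h1 := pow_mul_exp_le_exp_neg_mul (m := (mχ j : ℝ)) (Λ := Λ) (β := ((g (j + 1)) ^ 2)⁻¹) (ε := epsOfRecord ν g (j + 1) / B)
      (P := p0Profile ν.A₀ ν.p₀ (g (j + 1)) ^ 2) (hm1 j) hδ hNpos hB
      (by rw [inv_sq_mul_div_sq ν g (j + 1) (hg0 j hj).ne']) hPj (D' j).card
    refine h1.trans (Real.exp_le_exp.2 (mul_le_mul_of_nonneg_right (neg_le_neg ?_) (Nat.cast_nonneg _)))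
    have hlogm : 0 ≤ Real.log (mχ j : ℝ) := Real.log_nonneg (hm1 j)
    have h4 : 0 < 4 * N' * B ^ 2 := by positivity
    rw [le_div_iff₀ h4]
    have h5 : 4 * N' * B ^ 2 * Λ ≤ 4 * N' * B ^ 2 * (Λ + Real.log (mχ j : ℝ) / δ) :=
      mul_le_mul_of_nonneg_left (le_add_of_nonneg_right (div_nonneg hlogm hδ.le)) h4.le
    nlinarith [h5, hPj, hδ]
  -- the two named Props on the skeleton (module 48 §5)
  have key := halves_rec_pinnedLevels_hullWindow_of_regularity F N ν M p g A₁ hρ h0 J hJ D'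
    (fun j c => Finset.univ.filter fun q : Plaq (F.P p.K) (j + 1) => embIter (j + 1) q.src ∈ cubeEnl (F.P p.K) (sideχ F ν p g j) c 4)
    mχ (fun j => epsOfRecord ν g (j + 1) / B) hε0 hm (fun j _ c₁ hc₁ c₂ hc₂ hne => hdisj j c₁ hc₁ c₂ hc₂ hne) hεη
    (fun j hj c _ V' U₀ hmin hsm => hThm1 j hj c V' U₀ hmin fun p' hp' => hsm p' ((mem_canon_iff F ν p g j c p').2 hp'))
    (fun _ => α) (fun j => ((g (j + 1)) ^ 2)⁻¹) (fun _ => C) (fun _ => a₀) (fun _ => δ) rate (fun _ _ => hα) (fun _ _ => hguard)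
    (fun j _ => by positivity) (fun _ _ => hC) (fun _ _ => hδ.le) (fun _ _ => hδa)
    (fun j _ => rfl) hrate0 K' E (fun j hj h t ht => (hsub j).trans (hE j hj h t ht))
    (hLSw_of_window F N ν M p g A₁ E D' hW)
  refine ⟨D', hsub, hK, fun j c₁ hc₁ c₂ hc₂ hne => hdisj j c₁ hc₁ c₂ hc₂ hne, key.1, key.2, fun j hj => ?_⟩
  -- the stability exponent: `log (rate j) ≤ −δΛ·#D′_j`
  have h := Real.log_le_log (hrate0 j hj) (hlevel j hj)
  rwa [Real.log_exp] at h

end Summit.QuantumFields.YangMills.BalabanUVNodes.N20LCSNamedPropsOfAny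

end
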